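import Mathlib
import Literature.NumberTheory.Sieve.Maynard2016OmegaSmall
import Literature.NumberTheory.Sieve.Maynard2016Growth
import HarnessLib

/-!
# Maynard 2016: a lower bound for the class density `∏_{p ≤ w}(1 − ω_m(p)/p)` (`m` even)

Topic `Literature/NumberTheory/Sieve`. J. Maynard, *Large gaps between primes*, Ann. of Math. (2)
183 (2016), 915–933 = arXiv:1408.5110, §4 ("`P_w = o(log₂ x)`") and §6 displays (6.17), (6.20),
(6.30): for even `m` every local factor `1 − ω_m(p)/p` (`ω_m(p) = 1` if `p ∣ m`, `2` if `p ∤ m`) is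
`≥ 1/3`, so the density of the classes `n (mod P_w)` with `(n(mn − 1), P_w) = 1` is at least
`3^{−π(w)} ≥ 3^{−(⌊w⌋+1)} ≥ 1/(3 (log₃ x)²)` (`w = log₄ x`) — polylogarithmically small only, which
makes the `O(P_w)` boundary error of the class count negligible against `(U/m) · density`.

PROVED here (no named facts): `third_le_local_density`, `local_density_pos`, `density_pos`,
`third_pow_le_density`, `three_pow_floor_wFun_succ_le`, `inv_log₃_sq_le_density`.

## References

* J. Maynard, *Large gaps between primes*, Ann. of Math. (2) 183 (2016), 915–933; arXiv:1408.5110,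
  §4, §6 (6.17), (6.20), (6.30). [Maynard2016LargeGaps]
-/

open Filter Finset
open scoped Topology

namespace Literature.NumberTheory.Sieve

namespace Maynard2016

/-- For even `m` and a prime `p`: `1/3 ≤ 1 − ω_m(p)/p`. [cite: Maynard2016LargeGaps, §6 display (6.17)] -/
theorem third_le_local_density {m p : ℕ} (hm : Even m) (hp : p.Prime) :
    (1 / 3 : ℝ) ≤ 1 - ((if p ∣ m then 1 else 2 : ℕ) : ℝ) / p := by
  have hp2 : (2 : ℝ) ≤ p := by exact_mod_cast hp.two_le
  have hp0 : (0 : ℝ) < p := by linarith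
  split_ifs with hpm
  · push_cast
    have : (1 : ℝ) / p ≤ 1 / 2 := by
      rw [div_le_div_iff₀ hp0 two_pos]; linarith
    linarith
  · have hp3 : (3 : ℝ) ≤ p := by
      have hne : p ≠ 2 := by
        rintro rfl
        exact hpm (even_iff_two_dvd.1 hm)
      have := hp.two_le
      exact_mod_cast (show 3 ≤ p by omega)
    push_cast
    have : (2 : ℝ) / p ≤ 2 / 3 := by
      rw [div_le_div_iff₀ hp0 three_pos]; linarith
    linarith

/-- Every local factor is positive (even `m`). [cite: Maynard2016LargeGaps, §6 display (6.17)] -/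
theorem local_density_pos {m p : ℕ} (hm : Even m) (hp : p.Prime) :
    (0 : ℝ) < 1 - ((if p ∣ m then 1 else 2 : ℕ) : ℝ) / p :=
  lt_of_lt_of_le (by norm_num) (third_le_local_density hm hp)

/-- `0 < ∏_{p ≤ w}(1 − ω_m(p)/p)` for even `m`. [cite: Maynard2016LargeGaps, §6 display (6.17)] -/
theorem density_pos {m : ℕ} (hm : Even m) (x : ℕ) :
    0 < ∏ p ∈ (Finset.Iic ⌊wFun x⌋₊).filter Nat.Prime,
      (1 - ((if p ∣ m then 1 else 2 : ℕ) : ℝ) / p) :=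
  Finset.prod_pos fun _ hp => local_density_pos hm (Finset.mem_filter.1 hp).2

/-- `(1/3)^{⌊w⌋+1} ≤ ∏_{p ≤ w}(1 − ω_m(p)/p)` for even `m`. [cite: Maynard2016LargeGaps, §6 display (6.17)] -/
theorem third_pow_le_density {m : ℕ} (hm : Even m) (x : ℕ) :
    (1 / 3 : ℝ) ^ (⌊wFun x⌋₊ + 1) ≤ ∏ p ∈ (Finset.Iic ⌊wFun x⌋₊).filter Nat.Prime,
      (1 - ((if p ∣ m then 1 else 2 : ℕ) : ℝ) / p) := by
  have hcard : ((Finset.Iic ⌊wFun x⌋₊).filter Nat.Prime).card ≤ ⌊wFun x⌋₊ + 1 :=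
    (Finset.card_filter_le _ _).trans (by simp)
  calc (1 / 3 : ℝ) ^ (⌊wFun x⌋₊ + 1)
      ≤ (1 / 3 : ℝ) ^ ((Finset.Iic ⌊wFun x⌋₊).filter Nat.Prime).card :=
        pow_le_pow_of_le_one (by norm_num) (by norm_num) hcard
    _ = ∏ p ∈ (Finset.Iic ⌊wFun x⌋₊).filter Nat.Prime, (1 / 3 : ℝ) := by
        rw [Finset.prod_const]
    _ ≤ _ := Finset.prod_le_prod (fun p _ => by norm_num)
        fun p hp => third_le_local_density hm (Finset.mem_filter.1 hp).2

/-- `3^{⌊w⌋+1} ≤ 3 (log₃ x)²` once `log₃ x ≥ 1` (`3^w = e^{w log 3} ≤ e^{2w} = (log₃ x)²`,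
`w = log₄ x`). [cite: Maynard2016LargeGaps, §4 («P_w = o(log₂ x)»)] -/
theorem three_pow_floor_wFun_succ_le {x : ℕ} (hL₃ : 1 ≤ Real.log (Real.log (Real.log x))) :
    (3 : ℝ) ^ (⌊wFun x⌋₊ + 1) ≤ 3 * Real.log (Real.log (Real.log x)) ^ 2 := by
  set L₃ := Real.log (Real.log (Real.log x)) with hL₃def
  have hL₃0 : 0 < L₃ := by linarith
  have hw0 : 0 ≤ wFun x := wFun_nonneg hL₃
  have h1 : (3 : ℝ) ^ ⌊wFun x⌋₊ ≤ (3 : ℝ) ^ (wFun x) := by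
    rw [← Real.rpow_natCast]
    exact Real.rpow_le_rpow_of_exponent_le (by norm_num) (Nat.floor_le hw0)
  have h2 : (3 : ℝ) ^ (wFun x) ≤ Real.exp (2 * wFun x) := by
    rw [Real.rpow_def_of_pos (by norm_num : (0 : ℝ) < 3)]
    apply Real.exp_le_exp.2
    have h3 : Real.log 3 ≤ 2 := by
      rw [Real.log_le_iff_le_exp (by norm_num)]
      have := Real.add_one_le_exp (2 : ℝ)
      linarith
    nlinarith
  have h4 : Real.exp (2 * wFun x) = L₃ ^ 2 := by
    unfold wFun; rw [← hL₃def, ← Real.exp_log hL₃0]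
    rw [Real.log_exp, ← Real.exp_nat_mul]; norm_num
  rw [pow_succ]
  nlinarith [h4.le, h1, h2]

/-- **Density lower bound**: `1/(3 (log₃ x)²) ≤ ∏_{p ≤ w}(1 − ω_m(p)/p)` for even `m`, once
`log₃ x ≥ 1`. [cite: Maynard2016LargeGaps, §6 displays (6.17), (6.20)] -/
theorem inv_log₃_sq_le_density {m : ℕ} (hm : Even m) {x : ℕ}
    (hL₃ : 1 ≤ Real.log (Real.log (Real.log x))) :
    1 / (3 * Real.log (Real.log (Real.log x)) ^ 2) ≤
      ∏ p ∈ (Finset.Iic ⌊wFun x⌋₊).filter Nat.Prime,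
        (1 - ((if p ∣ m then 1 else 2 : ℕ) : ℝ) / p) := by
  refine le_trans ?_ (third_pow_le_density hm x)
  have h3 : (0 : ℝ) < (3 : ℝ) ^ (⌊wFun x⌋₊ + 1) := by positivity
  rw [one_div_pow, one_div_le_one_div (by positivity) h3]
  exact three_pow_floor_wFun_succ_le hL₃

end Maynard2016

end Literature.NumberTheory.Sieve
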